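import Mathlib
import Summits.PneNP.PneNP.Theses.OverlapGapAlgebra

/-!
# Sketch — crux-ideate stmt-PneNP-2463 (SolvableImpliesStableSection), ideator 2, round 1

First lemmas of the two idea cards, stated over existing declarations (Mathlib + the route file).
Nothing here is proved (`sorry`); the point is that the signatures elaborate.

* Card `cloud-smoothing-coherence`: `noiseOp`, `totInf`, `totInf_noiseOp_le` (Efron–Stein
  contraction: smoothing gives constant "effective degree"), `pathJumps_le_totInf` (Markov +
  Cauchy–Schwarz along the Bresler–Huang splice path: few large steps), `IsCoherentAt`,
  `CoherentlySolvable`, and the shape of the transfer `coherent_transfer_shape`.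
* Card `local-simulability`: `clausesTouching`, `ball`, `IsLocalRule`, `lightCone_hammingDist_le`
  (deterministic light-cone stability of a labelled `r`-local rule under a one-literal change).
-/

set_option linter.dupNamespace false

namespace Summit.PneNP.PneNP.Cruxes.SolvableImpliesStableSection.Sketch

open Finset
open scoped Classical

variable {k m n : ℕ}

/-- Instances: uniform literal arrays, as in the route file. -/
abbrev Inst (k m n : ℕ) := Fin m → Fin k → Fin n × Bool

/-! ## Card A — cloud smoothing: stability is free, coherence is the crux -/

/-- Bonami–Beckner noise operator on the literal product space `(Fin n × Bool)^(m·k)`: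
each literal kept with probability `ρ`, resampled uniformly with probability `1-ρ`
(written as an explicit finite average; `2n = |Fin n × Bool|`). -/
noncomputable def noiseOp (ρ : ℝ) (h : Inst k m n → Fin n → ℝ) : Inst k m n → Fin n → ℝ :=
  fun Φ j => ∑ Φ' : Inst k m n,
    (∏ a : Fin m, ∏ b : Fin k, (ρ * (if Φ' a b = Φ a b then (1 : ℝ) else 0) + (1 - ρ) / (2 * n)))
      * h Φ' j

/-- Total (resampling) influence of a vector field on instance space: one half of the sum over
coordinates `(a,b)` of `E_{Φ,ℓ} ‖h Φ - h Φ[(a,b) ↦ ℓ]‖₂²` (Efron–Stein / `∑_j E Var_j`). -/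
noncomputable def totInf (h : Inst k m n → Fin n → ℝ) : ℝ :=
  (∑ Φ : Inst k m n, ∑ a : Fin m, ∑ b : Fin k, ∑ ℓ : Fin n × Bool, ∑ j : Fin n,
      (h Φ j - h (Function.update Φ a (Function.update (Φ a) b ℓ)) j) ^ 2)
    / (2 * ((Fintype.card (Inst k m n) : ℝ) * (2 * n)))

/-- **Smoothing gives constant effective degree** (the engine's analytic input): for a
`[0,1]`-valued field, `I(T_ρ h) = ∑_S |S| ρ^{2|S|} ‖ĥ_S‖² ≤ max_d (d ρ^{2d}) · ∑_j Var h_j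
≤ n / (8 e log(1/ρ))`.  Compare Bresler–Huang Lemma 6.4 (degree-`D` polynomials: `≤ D · Var`). -/
theorem totInf_noiseOp_le (ρ : ℝ) (hρ0 : 0 < ρ) (hρ1 : ρ < 1) (hn : 0 < n)
    (h : Inst k m n → Fin n → ℝ) (hh : ∀ Φ j, h Φ j ∈ Set.Icc (0 : ℝ) 1) :
    totInf (noiseOp ρ h) ≤ n / (8 * Real.exp 1 * Real.log (1 / ρ)) := by
  sorry

/-- **First lemma of card A (f-free, elementary).** Along the Bresler–Huang splice path of the
crux (same parametrisation `P` as `SolvableImpliesStableSection`), the number of steps at which a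
field moves by more than `η n` in `ℓ¹`, summed over all `Ψ`, is at most
`(2k · totInf h / (η² n)) · #Ψ`: each path edge is a (uniform instance, one fresh literal) pair,
each coordinate is switched `k` times, Cauchy–Schwarz turns an `ℓ¹` jump `> ηn` into an `ℓ²`
jump `> η² n`, and Markov does the rest. With `totInf_noiseOp_le` the bound is the constant
`k / (4 e η² log(1/ρ)) · #Ψ`; Bresler–Huang Lemma 6.5 then upgrades "few bad steps on average"
to "no bad step with probability ≥ (2n)^{-O(1)}". -/
theorem pathJumps_le_totInf (k m n : ℕ) (η : ℝ) (hη : 0 < η)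
    (h : Inst k m n → Fin n → ℝ) :
    let P : (Fin (k + 1) → Inst k m n) → Fin k → ℕ → Inst k m n :=
      fun Ψ r q a b => if (a : ℕ) * k + b < q then Ψ r.succ a b else Ψ r.castSucc a b
    (((∑ Ψ : Fin (k + 1) → Inst k m n,
        ((Finset.univ : Finset (Fin k × Fin (m * k))).filter fun rq =>
          η * n < ∑ j, |h (P Ψ rq.1 rq.2) j - h (P Ψ rq.1 ((rq.2 : ℕ) + 1)) j|).card) : ℕ) : ℝ)
      ≤ 2 * k * totInf h / (η ^ 2 * n) * Fintype.card (Fin (k + 1) → Inst k m n) := by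
  sorry

/-- Rounding with a dead zone (Bresler–Huang's `round`, shifted to `[0,1]`): `none` = uncertain. -/
noncomputable def roundDZ (θ : ℝ) (y : ℝ) : Option Bool :=
  if 1 / 2 + θ ≤ y then some true else if y ≤ 1 / 2 - θ then some false else none

/-- **Coherence at `Φ`** (the residual, path-free notion): the dead-zone rounding of the smoothed
field has at most `η n` uncertain coordinates and, completed by `false` on them, violates at
most `ν m` clauses of `Φ` itself. -/
def IsCoherentAt (ρ θ η ν : ℝ) (h : Inst k m n → Fin n → ℝ) (Φ : Inst k m n) : Prop :=
  ((Finset.univ.filter fun j => roundDZ θ (noiseOp ρ h Φ j) = none).card : ℝ) ≤ η * n ∧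
    ((Finset.univ.filter fun i : Fin m =>
        ∀ b, ((roundDZ θ (noiseOp ρ h Φ (Φ i b).1)).getD false) ≠ (Φ i b).2).card : ℝ) ≤ ν * m

/-- **Coherently solvable at `(k, α)`** with tolerances `(η, ν)`: some field (no complexity bound)
is coherent on a non-vanishing fraction of instances, infinitely often — the conclusion of the
transfer `C⁺`. -/
def CoherentlySolvable (k : ℕ) (α η ν : ℝ) : Prop :=
  ∃ ρ θ : ℝ, 0 < ρ ∧ ρ < 1 ∧ 0 < θ ∧ ∃ ε : ℝ, 0 < ε ∧ ∃ᶠ n : ℕ in Filter.atTop, ∀ m : ℕ,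
    m = ⌊α * n⌋₊ → ∃ h : Inst k m n → Fin n → ℝ, (∀ Φ j, h Φ j ∈ Set.Icc (0 : ℝ) 1) ∧
      ε ≤ ((Finset.univ.filter fun Φ : Inst k m n => IsCoherentAt ρ θ η ν h Φ).card : ℝ) /
        Fintype.card (Inst k m n)

/-- **Shape of the line** (engine + transfer ⇒ crux). `engine`: coherent solvability at every
smaller tolerance gives the crux's path event with probability `≥ e^{-cn}` (in fact
`≥ e^{-O(√n log n)}`); `transfer`: efficient solvability ⇒ coherent solvability. -/
theorem coherent_transfer_shape
    (engine : ∀ k : ℕ, 3 ≤ k → ∀ α η ν : ℝ, 0 < α → 0 < η → 0 < ν →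
      (∀ η' ν' : ℝ, 0 < η' → 0 < ν' → CoherentlySolvable k α η' ν') →
      ∀ c : ℝ, 0 < c → ∃ᶠ n : ℕ in Filter.atTop, ∀ m : ℕ, m = ⌊α * n⌋₊ →
        ∃ g : (Fin m → Fin k → Fin n × Bool) → (Fin n → Bool),
          Real.exp (-(c * n)) * Fintype.card (Fin (k + 1) → Fin m → Fin k → Fin n × Bool) ≤
          ((Finset.univ.filter fun Ψ : Fin (k + 1) → Fin m → Fin k → Fin n × Bool =>
            let P : Fin k → ℕ → Fin m → Fin k → Fin n × Bool :=
              fun r q a b => if (a : ℕ) * k + b < q then Ψ r.succ a b else Ψ r.castSucc a b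
            (∀ r : Fin k, ∀ q ≤ m * k, ((Finset.univ.filter fun i : Fin m =>
              ∀ j, g (P r q) (P r q i j).1 ≠ (P r q i j).2).card : ℝ) ≤ ν * m) ∧
            ∀ r : Fin k, ∀ q < m * k, (hammingDist (g (P r q)) (g (P r (q + 1))) : ℝ) ≤ η * n).card : ℝ))
    (transfer : ∀ k : ℕ, 3 ≤ k → ∀ α η ν : ℝ, 0 < α → 0 < η → 0 < ν →
      (∃ f : List Bool → List Bool, Literature.Computability.Complexity.IsPolyTime f ∧ ∃ ε : ℝ,
        0 < ε ∧ ∃ᶠ n : ℕ in Filter.atTop, ∀ m : ℕ, m = ⌊α * n⌋₊ → ε ≤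
          ((Finset.univ.filter fun Φ : Fin m → Fin k → Fin n × Bool => ∀ i, ∃ j,
            (f (Literature.Computability.Complexity.encodingCNF.encode (List.ofFn fun a =>
              List.ofFn fun b => (((Φ a b).1 : ℕ), (Φ a b).2)))).getD (Φ i j).1 false =
                (Φ i j).2).card : ℝ) / Fintype.card (Fin m → Fin k → Fin n × Bool)) →
      CoherentlySolvable k α η ν) :
    Summit.PneNP.PneNP.Theses.OverlapGapAlgebra.SolvableImpliesStableSection := by
  intro k hk α η ν hα hη hν hsolv c hc
  exact engine k hk α η ν hα hη hν (fun η' ν' hη' hν' => transfer k hk α η' ν' hα hη' hν' hsolv) c hc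

/-! ## Card B — local simulability: light cones give sections -/

/-- Clauses of `Φ` containing a variable of `V`. -/
def clausesTouching (Φ : Inst k m n) (V : Finset (Fin n)) : Finset (Fin m) :=
  Finset.univ.filter fun a => ∃ b, (Φ a b).1 ∈ V

/-- One step of factor-graph growth: add all variables sharing a clause with `V`. -/
def grow (Φ : Inst k m n) (V : Finset (Fin n)) : Finset (Fin n) :=
  V ∪ (clausesTouching Φ V).biUnion fun a => Finset.univ.image fun b => (Φ a b).1

/-- Variables within factor-graph distance `2r` of `v`. -/
def ball (Φ : Inst k m n) (r : ℕ) (v : Fin n) : Finset (Fin n) := (grow Φ)^[r] {v}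

/-- A (labelled) `r`-local rule: the value at `v` is determined by the clauses meeting the
radius-`r` ball of `v` (Bresler–Huang Def. 2.11–2.12 use the unlabelled, decorated version; the
labelled one is weaker and is all the light-cone lemma needs). -/
def IsLocalRule (r : ℕ) (g : Inst k m n → Fin n → Bool) : Prop :=
  ∀ Φ Φ' : Inst k m n, ∀ v : Fin n,
    (∀ a, a ∈ clausesTouching Φ (ball Φ r v) ∪ clausesTouching Φ' (ball Φ' r v) → Φ a = Φ' a) →
      g Φ v = g Φ' v

/-- **First lemma of card B (deterministic light cone).** Changing one literal of clause `a`
moves the output of an `r`-local rule only inside the radius-`r` light cone of `a` (in either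
factor graph); along the splice path this is the per-step movement, `polylog(n) ≪ η n` w.h.p. -/
theorem lightCone_hammingDist_le (r : ℕ) (g : Inst k m n → Fin n → Bool) (hg : IsLocalRule r g)
    (Φ : Inst k m n) (a : Fin m) (b : Fin k) (ℓ : Fin n × Bool) :
    hammingDist (g Φ) (g (Function.update Φ a (Function.update (Φ a) b ℓ))) ≤
      (Finset.univ.filter fun v : Fin n =>
        a ∈ clausesTouching Φ (ball Φ r v) ∪
          clausesTouching (Function.update Φ a (Function.update (Φ a) b ℓ))
            (ball (Function.update Φ a (Function.update (Φ a) b ℓ)) r v)).card := by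
  sorry

/-- **Local simulability** (the transfer target `C⁺⁺` of card B, k-SAT instance): efficient
solvability with non-vanishing probability at `(k, α)` forces, for every tolerance `ν`, some
labelled `r`-local rule whose own output violates at most `ν m` clauses on a non-vanishing
fraction of instances, infinitely often. -/
def LocallySimulable (k : ℕ) (α : ℝ) : Prop :=
  (∃ f : List Bool → List Bool, Literature.Computability.Complexity.IsPolyTime f ∧ ∃ ε : ℝ,
      0 < ε ∧ ∃ᶠ n : ℕ in Filter.atTop, ∀ m : ℕ, m = ⌊α * n⌋₊ → ε ≤
        ((Finset.univ.filter fun Φ : Fin m → Fin k → Fin n × Bool => ∀ i, ∃ j,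
          (f (Literature.Computability.Complexity.encodingCNF.encode (List.ofFn fun a =>
            List.ofFn fun b => (((Φ a b).1 : ℕ), (Φ a b).2)))).getD (Φ i j).1 false =
              (Φ i j).2).card : ℝ) / Fintype.card (Fin m → Fin k → Fin n × Bool)) →
    ∀ ν : ℝ, 0 < ν → ∃ r : ℕ, ∃ ε : ℝ, 0 < ε ∧ ∃ᶠ n : ℕ in Filter.atTop, ∀ m : ℕ, m = ⌊α * n⌋₊ →
      ∃ g : Inst k m n → Fin n → Bool, IsLocalRule r g ∧
        ε ≤ ((Finset.univ.filter fun Φ : Inst k m n =>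
          ((Finset.univ.filter fun i : Fin m => ∀ b, g Φ (Φ i b).1 ≠ (Φ i b).2).card : ℝ) ≤
            ν * m).card : ℝ) / Fintype.card (Inst k m n)

end Summit.PneNP.PneNP.Cruxes.SolvableImpliesStableSection.Sketch
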